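import Literature.AlgebraicGeometry.AbelianSchemes.DualPairFibreDim
import Literature.AlgebraicGeometry.AbelianSchemes.AbelianSchemeRelDimOfConnected
import Literature.AlgebraicGeometry.AbelianSchemes.AbelianSchemeLocalRelDim
import HarnessLib

/-!
# `dim Â_s = dim A_s` at EVERY point of a connected (or local) base, from ONE witness point

Layer `Literature/AlgebraicGeometry/AbelianSchemes`, namespace `Literature.AlgebraicGeometry.AbelianSchemes.AbelianSchemeOver`
(`.DualPair`, `.Polarization`).  THEOREMS ONLY (no definition, no named fact, no instance, no notation, no `sorry`; net Literature debt 0).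

THE POINT.  The tree's dual pair `D = (Â, 𝒫)` of an abelian scheme `A/S` (★ `AbelianSchemeDualPair`) pins `Â` only through its universal
property, so the printed «`dim A^∨ = dim A`» ([MumfordAV1970] §13 Cor. 3; [MilneAV2008] I §8) is not a field of the carrier; ★ `DualPairFibreDim`
proves it at the points whose residue field embeds in `ℂ` (characteristic ZERO).  In characteristic `p` the tree has no direct proof.  But `Â → S`
is itself an abelian scheme, so over a CONNECTED base both `A` and `Â` have ONE relative dimension (★ `exists_isOfRelDim`,
[MumfordFogartyKirwan1994] Def. 7.2 (i); [GortzWedhorn2020] Remark 16.54: the relative dimension of a smooth morphism is locally constant), and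
ONE witness point — e.g. a characteristic-zero point of a flat model, where ★ `Polarization.dim_hat_fibre_eq` applies — propagates
`dim Â_s = dim A_s` to every point, in particular to the points of positive characteristic:

* §1 `dim_fibre_eq_dim_fibre_of_connectedSpace` — two abelian schemes over a connected base whose fibre dimensions agree at ONE field-valued
  point agree at ALL of them; `DualPair.dim_hat_fibre_eq_dim_fibre_of_connectedSpace` — the case `B := Â`;
* §2 the LOCAL form (no global connectedness: `Spec C` is connected for a local ring `C`, ★ `AbelianSchemeLocalRelDim`):
  `dim_fibre_comp_eq_dim_fibre_comp_of_isLocalRing`, `DualPair.dim_hat_fibre_comp_eq_of_isLocalRing` — through any `c : Spec C → S`, `C` local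
  (e.g. `Spec 𝒪_{S,x} → S`, whose points are the generalisations of `x`), one witness point through `c` gives all points through `c`;
* §3 the witness from a POLARISATION at a point whose residue field embeds in `ℂ` (★ `Polarization.dim_hat_fibre_eq`):
  `Polarization.dim_hat_fibre_eq_dim_fibre_of_connectedSpace` (`Scheme.{0}`);
* §4 the consumer packaging in the ITERATED-BASE-CHANGE currency of the P6 special fibre (`sch₀Of = (𝒜 ×_S S′) ×_{S′} Spec k`,
  `dual₀Of = (D.baseChange f).baseChange x`, `fibre₀Of = (sch₀Of).toAffine.toAbelianVariety` — definitional bridges ★ `fibre`, ★ `baseChange_hat`):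
  `DualPair.dim_hat_baseChange_baseChange_eq` — `dim (((D.baseChange f).baseChange x).hat) = dim ((𝒜.baseChange f).baseChange x)` from the
  fibre statement at `x ≫ f` (★ `dim_fibre_eq_of_isBaseChangeVia` along ★ `baseChange_isBaseChangeVia`).

Cell `hodgecm-mathlib` (D-0151 ∕ floor 0 D-0183), programme F0∕P6 «MOD», row **(W-hdim)** (LEAD F0P6-plan (g2) «M-17v′» 22:03Z ∕ re-deal
22:22Z; pen F0P6b-plan (g3)): the supplier of the binder `hdim : D.hat.toAffine.toAbelianVariety.dim = A.dim` of the W-line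
(`Cruxes/HLiu418/Lines/F0_P6b_WeilCartierDuality.lean` ED. 2: `WeilFamily`, `theFamily`, `e₀`) at the geometric special point `x̄`;
`--supports stmt-HodgeConjecture-24832`, count-neutral.  HONEST LABEL: HC_CM is proved only modulo the 2 remaining named inputs (hLiu418 24832,
h413 24833) until rung 0 closes; this file discharges none of them and nothing here is about HC.

## References
* [MumfordAV1970] D. Mumford, *Abelian Varieties* (1970), §13 Cor. 3 (p. 130) («`dim Â = dim A`»), §8 Thm. 1 (p. 77).
* [MilneAV2008] J. S. Milne, *Abelian Varieties* (v2.00, 2008), I §8 pp. 36–37, Rem. 8.8.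
* [MumfordFogartyKirwan1994] D. Mumford, J. Fogarty, F. Kirwan, *GIT* 3rd ed. (1994), Ch. 6 §1 Cor. 6.8 (p. 118), Ch. 7 §2 Def. 7.2 (p. 129).
* [GortzWedhorn2020] U. Görtz, T. Wedhorn, *Algebraic Geometry I* (2nd ed., 2020), Remark 16.54, Section (4.7), Prop. 4.16 (p. 101).
-/

noncomputable section

universe u

open CategoryTheory CategoryTheory.Limits AlgebraicGeometry

namespace Literature.AlgebraicGeometry.AbelianSchemes

namespace AbelianSchemeOver

/-! ### §1 Over a connected base: one witness point gives all points -/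

section Connected

variable {S : Scheme.{u}}

/-- **Two abelian schemes over a CONNECTED base whose fibre dimensions agree at one field-valued point agree at every field-valued
point**: each has one relative dimension (★ `exists_isOfRelDim`), read off at any fibre (★ `dim_fibre_of_isOfRelDim`).
[cite: MumfordFogartyKirwan1994, Ch. 7 §2 Definition 7.2 (p. 129)] [cite: GortzWedhorn2020, Remark 16.54 (p. 539)] -/
theorem dim_fibre_eq_dim_fibre_of_connectedSpace [ConnectedSpace S] (A B : AbelianSchemeOver S)
    {Ω₀ : Type u} [Field Ω₀] (s₀ : Spec (.of Ω₀) ⟶ S)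
    (h₀ : (B.fibre s₀).toAbelianVariety.dim = (A.fibre s₀).toAbelianVariety.dim)
    {Ω : Type u} [Field Ω] (s : Spec (.of Ω) ⟶ S) :
    (B.fibre s).toAbelianVariety.dim = (A.fibre s).toAbelianVariety.dim := by
  obtain ⟨g, hg⟩ := A.exists_isOfRelDim
  obtain ⟨g', hg'⟩ := B.exists_isOfRelDim
  rw [dim_fibre_of_isOfRelDim hg s₀, dim_fibre_of_isOfRelDim hg' s₀] at h₀
  rw [dim_fibre_of_isOfRelDim hg s, dim_fibre_of_isOfRelDim hg' s, h₀]

/-- **`dim Â_s = dim A_s` at EVERY point of a connected base from ONE witness point** (`Â = D.hat` is an abelian scheme over `S`).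
[cite: MumfordAV1970, §13 Cor. 3 (p. 130)] [cite: MumfordFogartyKirwan1994, Ch. 7 §2 Definition 7.2 (p. 129)] -/
theorem DualPair.dim_hat_fibre_eq_dim_fibre_of_connectedSpace [ConnectedSpace S] {A : AbelianSchemeOver S} (D : A.DualPair)
    {Ω₀ : Type u} [Field Ω₀] (s₀ : Spec (.of Ω₀) ⟶ S)
    (h₀ : (D.hat.fibre s₀).toAbelianVariety.dim = (A.fibre s₀).toAbelianVariety.dim)
    {Ω : Type u} [Field Ω] (s : Spec (.of Ω) ⟶ S) :
    (D.hat.fibre s).toAbelianVariety.dim = (A.fibre s).toAbelianVariety.dim :=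
  dim_fibre_eq_dim_fibre_of_connectedSpace A D.hat s₀ h₀ s

end Connected

/-! ### §2 The local form: through `c : Spec C → S` with `C` local (no global connectedness) -/

section Local

variable {S : Scheme.{u}} {C : Type u} [CommRing C] [IsLocalRing C]

/-- **Through the spectrum of a LOCAL ring** (`c : Spec C → S`, e.g. `Spec 𝒪_{S,x} → S`): two abelian schemes over `S` whose fibre dimensions
agree at one point through `c` agree at every point through `c` — `Spec C` is connected, so `A ×_S Spec C`, `B ×_S Spec C` have one relative
dimension each (★ `exists_isOfRelDim_baseChange_of_isLocalRing`), read at the fibres of `A`, `B` themselves (★ `dim_fibre_comp_eq_of_isOfRelDim_baseChange`).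
[cite: GortzWedhorn2020, Remark 16.54 (p. 539)] [cite: MumfordFogartyKirwan1994, Ch. 7 §2 Definition 7.2 (p. 129)] -/
theorem dim_fibre_comp_eq_dim_fibre_comp_of_isLocalRing (A B : AbelianSchemeOver S) (c : Spec (.of C) ⟶ S)
    {Ω₀ : Type u} [Field Ω₀] (s₀ : Spec (.of Ω₀) ⟶ Spec (.of C))
    (h₀ : (B.fibre (s₀ ≫ c)).toAbelianVariety.dim = (A.fibre (s₀ ≫ c)).toAbelianVariety.dim)
    {Ω : Type u} [Field Ω] (s : Spec (.of Ω) ⟶ Spec (.of C)) :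
    (B.fibre (s ≫ c)).toAbelianVariety.dim = (A.fibre (s ≫ c)).toAbelianVariety.dim := by
  obtain ⟨g, hg⟩ := A.exists_isOfRelDim_baseChange_of_isLocalRing c
  obtain ⟨g', hg'⟩ := B.exists_isOfRelDim_baseChange_of_isLocalRing c
  rw [dim_fibre_comp_eq_of_isOfRelDim_baseChange hg s₀, dim_fibre_comp_eq_of_isOfRelDim_baseChange hg' s₀] at h₀
  rw [dim_fibre_comp_eq_of_isOfRelDim_baseChange hg s, dim_fibre_comp_eq_of_isOfRelDim_baseChange hg' s, h₀]

/-- **`dim Â = dim A` at every point through `c : Spec C → S`, `C` local, from ONE witness point through `c`** — the form the P6 consumer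
uses at a special point `x` of a flat model: the points of `Spec 𝒪_{S,x}` are the generalisations of `x`, among them a characteristic-zero
point where §3 supplies the witness. [cite: MumfordAV1970, §13 Cor. 3 (p. 130)] [cite: GortzWedhorn2020, Remark 16.54 (p. 539)] -/
theorem DualPair.dim_hat_fibre_comp_eq_of_isLocalRing {A : AbelianSchemeOver S} (D : A.DualPair) (c : Spec (.of C) ⟶ S)
    {Ω₀ : Type u} [Field Ω₀] (s₀ : Spec (.of Ω₀) ⟶ Spec (.of C))
    (h₀ : (D.hat.fibre (s₀ ≫ c)).toAbelianVariety.dim = (A.fibre (s₀ ≫ c)).toAbelianVariety.dim)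
    {Ω : Type u} [Field Ω] (s : Spec (.of Ω) ⟶ Spec (.of C)) :
    (D.hat.fibre (s ≫ c)).toAbelianVariety.dim = (A.fibre (s ≫ c)).toAbelianVariety.dim :=
  dim_fibre_comp_eq_dim_fibre_comp_of_isLocalRing A D.hat c s₀ h₀ s

end Local

/-! ### §3 The witness from a polarisation at a point whose residue field embeds in `ℂ` -/

section Witness

variable {S : Scheme.{0}}

/-- **POLARISED, CONNECTED BASE, ONE POINT WITH RESIDUE FIELD IN `ℂ` ⇒ `dim Â_s = dim A_s` EVERYWHERE** (e.g. at the points of positive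
characteristic of a connected flat model whose generic fibre lives over a number field): the witness at `s₀` is ★ `Polarization.dim_hat_fibre_eq`
(uniqueness of the complex dual against ★ U-a3) and ★ `dim_fibre_of_isOfRelDim`; §1 propagates it.
[cite: MumfordAV1970, §13 Cor. 3 (p. 130)] [cite: MilneAV2008, I §8 pp. 36–37] [cite: MumfordFogartyKirwan1994, Ch. 7 §2 Definition 7.2 (p. 129)] -/
theorem Polarization.dim_hat_fibre_eq_dim_fibre_of_connectedSpace [ConnectedSpace S] {A : AbelianSchemeOver S} {D : A.DualPair}
    (pol : A.Polarization D) {Ω₀ : Type} [Field Ω₀] (s₀ : Spec (.of Ω₀) ⟶ S)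
    (hs₀ : Nonempty (S.residueField (s₀ (IsLocalRing.closedPoint Ω₀)) →+* ℂ))
    {Ω : Type} [Field Ω] (s : Spec (.of Ω) ⟶ S) :
    (D.hat.fibre s).toAbelianVariety.dim = (A.fibre s).toAbelianVariety.dim := by
  obtain ⟨g, hg⟩ := A.exists_isOfRelDim
  exact DualPair.dim_hat_fibre_eq_dim_fibre_of_connectedSpace D s₀
    ((pol.dim_hat_fibre_eq hg s₀ hs₀).trans (dim_fibre_of_isOfRelDim hg s₀).symm) s

/-- **The LOCAL polarised form**: through `c : Spec C → S` (`C` local), a polarisation of `A ×_S Spec C` (e.g. ★ `Polarization.baseChange` of a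
polarisation of `A`) and one point `s₀` of `Spec C` with residue field in `ℂ` give `dim Â = dim A` at every point through `c`.
[cite: MumfordAV1970, §13 Cor. 3 (p. 130)] [cite: GortzWedhorn2020, Remark 16.54 (p. 539)] -/
theorem Polarization.dim_hat_fibre_comp_eq_of_isLocalRing {C : Type} [CommRing C] [IsLocalRing C] {A : AbelianSchemeOver S} {D : A.DualPair}
    (c : Spec (.of C) ⟶ S) (polc : (A.baseChange c).Polarization (D.baseChange c))
    {Ω₀ : Type} [Field Ω₀] (s₀ : Spec (.of Ω₀) ⟶ Spec (.of C))
    (hs₀ : Nonempty ((Spec (.of C)).residueField (s₀ (IsLocalRing.closedPoint Ω₀)) →+* ℂ))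
    {Ω : Type} [Field Ω] (s : Spec (.of Ω) ⟶ Spec (.of C)) :
    (D.hat.fibre (s ≫ c)).toAbelianVariety.dim = (A.fibre (s ≫ c)).toAbelianVariety.dim := by
  obtain ⟨g, hg⟩ := A.exists_isOfRelDim_baseChange_of_isLocalRing c
  -- the witness at `s₀`, read on `A ×_S Spec C` and its dual `Â ×_S Spec C = (D.baseChange c).hat`
  have h₁ : ((D.baseChange c).hat.fibre s₀).toAbelianVariety.dim = g := polc.dim_hat_fibre_eq hg s₀ hs₀
  have h₂ : ((D.baseChange c).hat.fibre s₀).toAbelianVariety.dim = (D.hat.fibre (s₀ ≫ c)).toAbelianVariety.dim :=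
    dim_fibre_eq_of_isBaseChangeVia (D.hat.baseChange_isBaseChangeVia c) s₀
  refine DualPair.dim_hat_fibre_comp_eq_of_isLocalRing D c s₀ ?_ s
  rw [← h₂, h₁, dim_fibre_comp_eq_of_isOfRelDim_baseChange hg s₀]

end Witness

/-! ### §4 Consumer packaging: the iterated base change of the P6 special fibre -/

section Packaging

variable {S T : Scheme.{u}}

/-- **`dim` of the dual of the ITERATED base change `(D ×_S T) ×_T Spec k` equals `dim` of `(A ×_S T) ×_T Spec k`** — the literal binder
`hdim : D′.hat.toAffine.toAbelianVariety.dim = A′.dim` of the W-line at `A′ := ((A.baseChange f).baseChange x).toAffine.toAbelianVariety`,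
`D′ := (D.baseChange f).baseChange x` — from the fibre statement at `x ≫ f` (definitionally `(D.baseChange f).baseChange x).hat = (Â ×_S T) ×_T Spec k`
and `X.fibre x = (X.baseChange x).toAffine`, ★ `fibre`, ★ `baseChange_hat`; then ★ `dim_fibre_eq_of_isBaseChangeVia` along ★ `baseChange_isBaseChangeVia`).
[cite: MumfordFogartyKirwan1994, Ch. 6 §1 Cor. 6.8 (p. 118)] [cite: GortzWedhorn2020, Prop. 4.16 (p. 101)] -/
theorem DualPair.dim_hat_baseChange_baseChange_eq {A : AbelianSchemeOver S} (D : A.DualPair) (f : T ⟶ S)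
    {k : Type u} [Field k] (x : Spec (.of k) ⟶ T)
    (h : (D.hat.fibre (x ≫ f)).toAbelianVariety.dim = (A.fibre (x ≫ f)).toAbelianVariety.dim) :
    ((D.baseChange f).baseChange x).hat.toAffine.toAbelianVariety.dim =
      ((A.baseChange f).baseChange x).toAffine.toAbelianVariety.dim := by
  change ((D.hat.baseChange f).fibre x).toAbelianVariety.dim = ((A.baseChange f).fibre x).toAbelianVariety.dim
  rw [dim_fibre_eq_of_isBaseChangeVia (D.hat.baseChange_isBaseChangeVia f) x,
    dim_fibre_eq_of_isBaseChangeVia (A.baseChange_isBaseChangeVia f) x, h]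

/-- **The same, one base change deep**: `dim ((D.baseChange x).hat) = dim (A.baseChange x)` in the `toAffine.toAbelianVariety` currency, from
the fibre statement at `x` (definitional: ★ `fibre`, ★ `baseChange_hat`). [cite: MumfordFogartyKirwan1994, Ch. 6 §1 Cor. 6.8 (p. 118)] -/
theorem DualPair.dim_hat_baseChange_eq {A : AbelianSchemeOver S} (D : A.DualPair) {k : Type u} [Field k] (x : Spec (.of k) ⟶ S)
    (h : (D.hat.fibre x).toAbelianVariety.dim = (A.fibre x).toAbelianVariety.dim) :
    (D.baseChange x).hat.toAffine.toAbelianVariety.dim = (A.baseChange x).toAffine.toAbelianVariety.dim :=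
  h

end Packaging

end AbelianSchemeOver

end Literature.AlgebraicGeometry.AbelianSchemes

end
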